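import Mathlib.Algebra.Group.Prod
import Literature.AlgebraicGeometry.Frobenioids.ArchimedeanBaseCategory
import Literature.AlgebraicGeometry.Frobenioids.MonoidFunctors
import Literature.AlgebraicGeometry.Frobenioids.PerfFactorial
import HarnessLib

/-!
# Frobenioids II, Theorem 3.6 (preamble): the monoids `Φ^∡`, `Φ^fld`, `(Φ^fld)^Λ`

Mochizuki, *The geometry of Frobenioids II: poly-Frobenioids*, Kyushu J. Math. **62** (2008)
401–460, §3, the paragraph introducing Theorem 3.6 (author's kurims text p. 36)
[cite: MochizukiFrdII2008, Thm 3.6 p.36]: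

> "Also, denote by `Φ^∡` the restriction `Φ^∡₀|_D` to `D` of the functor `Φ^∡₀ : D₀ → Mon` determined
> by the assignment `(Ob(D₀) ∋) Spec(K) ↦ O_K^×` and by `Φ^fld` the functor `D → Mon` given by
> `(Ob(D) ∋ D) ↦ Φ^gp(D) × Φ^∡(D)` [so projecting to the two factors of the product monoid yields
> natural transformations `Φ^fld → Φ^∡`, `Φ^fld → Φ^gp`]. If `Λ = ℤ` (respectively, `Λ = ℚ`; `Λ = ℝ`),
> then write `(Φ^fld)^Λ := Φ^fld` (respectively, `(Φ^fld)^Λ := (Φ^fld)^pf`; `(Φ^fld)^Λ := Φ^gp`)."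

**Rendering.** `D₀` (connected finite étale coverings of `Spec ℝ`) is the 2-object skeleton `ArchFrd.D0`
of `ArchimedeanBaseCategory.lean` (seat abc-iut-L1-t6), in which every archimedean local field is read
inside `ℂ`: `O_K^× = ArchFrd.D0.unitScalars K ⊆ ℂ^×` (`{±1}` for `Spec ℝ`, `S¹` for `Spec ℂ`).
A "monoid on `D`" is a contravariant functor `Dᵒᵖ ⥤ CommMonCat` as in `ElementaryFrobenioid.lean`
([FrdI] Def. 1.1 (ii); multiplicative notation); the pull-back `O_K^× → O_L^×` along `Spec L → Spec K`
is the field embedding `K ↪ L`, i.e. the Galois action `ArchFrd.D0.galAct` of the arrow's twist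
(identity or complex conjugation). `Φ^gp`, `Φ^pf` are `groupificationFunctor`, `perfectionFunctor`
of `MonoidFunctors.lean`; `Λ ∈ {ℤ, ℚ, ℝ}` is `MonoidType` of `PerfFactorial.lean`.

Contents: `unitMonoid₀ = Φ^∡₀`, `unitMonoid π = Φ^∡ = Φ^∡₀|_D` for `π : D → D₀`, `fieldMonoid Φ π =
Φ^fld`, the two projections `fieldMonoidToGp`, `fieldMonoidToUnit`, and `fieldMonoidΛ Φ π Λ =
(Φ^fld)^Λ`. The functor laws of `Φ^∡₀` are PROVED (a Galois-action computation on `D₀`). Theorem 3.6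
itself is typed in `ArchimedeanBasicProperties.lean`. No statement of the paper is strengthened.
-/

namespace Literature.AlgebraicGeometry.Frobenioids

open CategoryTheory Opposite

universe w v u

namespace ArchFrd

namespace D0

/-- For an arrow `Spec L → Spec K` of `D₀` the scalars of `K` are scalars of `L` (`K ↪ L` inside `ℂ`).
[cite: MochizukiFrdII2008, Def 3.1 (ii) p.23] -/
theorem scalars_le_of_hom {L K : D0} (f : L ⟶ K) : scalars K ≤ scalars L := by
  cases f
  · exact le_rfl
  · rw [scalars_complex]; exact le_top
  · exact le_rfl

/-- The Galois twist of a composite arrow acts as the composite of the twists, on scalars of the final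
codomain (on real scalars every twist acts trivially). [cite: MochizukiFrdII2008, Def 3.1 (i) p.23] -/
theorem galAct_twists_comp {M L K : D0} (g : M ⟶ L) (f : L ⟶ K) {u : ℂˣ} (hu : u ∈ scalars K) :
    galAct (Hom.twists (g ≫ f)) u = galAct (Hom.twists g) (galAct (Hom.twists f) u) := by
  cases K
  · rw [twists_of_real, twists_of_real, galAct_false]
    exact (galAct_eq_self_of_mem_scalars_real _ hu).symm
  · rw [twists_comp_complex, galAct_xor, galAct_comm]

/-- The pull-back `O_K^× → O_L^×` of units of norm `1` along `Spec L → Spec K` (the field embedding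
`K ↪ L` read inside `ℂ`: the Galois action of the arrow's twist). [cite: MochizukiFrdII2008, Thm 3.6 p.36] -/
noncomputable def unitPull {L K : D0} (f : L ⟶ K) : unitScalars K →* unitScalars L where
  toFun u := ⟨galAct (Hom.twists f) (u : ℂˣ),
    ⟨galAct_mem_scalars _ (scalars_le_of_hom f u.2.1), by rw [norm_galAct]; exact u.2.2⟩⟩
  map_one' := Subtype.ext (map_one _)
  map_mul' a b := Subtype.ext (map_mul _ _ _)

/-- Underlying scalar of a pulled-back unit. [cite: MochizukiFrdII2008, Thm 3.6 p.36] -/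
@[simp] theorem coe_unitPull {L K : D0} (f : L ⟶ K) (u : unitScalars K) :
    ((unitPull f u : unitScalars L) : ℂˣ) = galAct (Hom.twists f) (u : ℂˣ) := rfl

end D0

/-- `Φ^∡₀ : D₀ → Mon`, "the functor determined by the assignment `Spec(K) ↦ O_K^×`" (FrdII Thm. 3.6,
p. 36), as a monoid on `D₀` in the sense of [FrdI] Def. 1.1 (ii) (contravariant, pull-back = field
embedding). [cite: MochizukiFrdII2008, Thm 3.6 p.36] -/
noncomputable def unitMonoid₀ : D0ᵒᵖ ⥤ CommMonCat.{0} where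
  obj K := CommMonCat.of (D0.unitScalars (unop K))
  map f := CommMonCat.ofHom (D0.unitPull f.unop)
  map_id K := by
    refine CommMonCat.hom_ext (MonoidHom.ext fun u => Subtype.ext ?_)
    show D0.galAct (D0.Hom.twists (𝟙 (unop K))) (u : ℂˣ) = u
    rw [D0.twists_id, D0.galAct_false]
  map_comp {K L M} f g := by
    refine CommMonCat.hom_ext (MonoidHom.ext fun u => Subtype.ext ?_)
    show D0.galAct (D0.Hom.twists (g.unop ≫ f.unop)) (u : ℂˣ) =
      D0.galAct (D0.Hom.twists g.unop) (D0.galAct (D0.Hom.twists f.unop) (u : ℂˣ))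
    exact D0.galAct_twists_comp g.unop f.unop u.2.1

/-- `Φ^∡₀(Spec K) = O_K^×`. [cite: MochizukiFrdII2008, Thm 3.6 p.36] -/
theorem unitMonoid₀_obj (K : D0ᵒᵖ) : (unitMonoid₀.obj K : Type) = D0.unitScalars (unop K) := rfl

section OverD

variable {D : Type u} [Category.{v} D] (Φ : Dᵒᵖ ⥤ CommMonCat.{w}) (π : D ⥤ D0)

/-- `Φ^∡ := Φ^∡₀|_D`, the restriction to `D` along `π : D → D₀` (FrdII Thm. 3.6, p. 36).
[cite: MochizukiFrdII2008, Thm 3.6 p.36] -/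
noncomputable abbrev unitMonoid : Dᵒᵖ ⥤ CommMonCat.{0} := π.op ⋙ unitMonoid₀

/-- `Φ^fld : D → Mon`, "`D ↦ Φ^gp(D) × Φ^∡(D)`" (FrdII Thm. 3.6, p. 36), for a monoid `Φ` on `D` and
`π : D → D₀`. [cite: MochizukiFrdII2008, Thm 3.6 p.36] -/
noncomputable def fieldMonoid : Dᵒᵖ ⥤ CommMonCat.{w} where
  obj A := CommMonCat.of ((groupificationFunctor Φ).obj A × (unitMonoid π).obj A)
  map f := CommMonCat.ofHom
    (MonoidHom.prodMap ((groupificationFunctor Φ).map f).hom ((unitMonoid π).map f).hom)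
  map_id A := by
    refine CommMonCat.hom_ext (MonoidHom.ext fun x => Prod.ext ?_ ?_)
    · show ((groupificationFunctor Φ).map (𝟙 A)).hom x.1 = x.1
      rw [CategoryTheory.Functor.map_id]; rfl
    · show ((unitMonoid π).map (𝟙 A)).hom x.2 = x.2
      rw [CategoryTheory.Functor.map_id]; rfl
  map_comp f g := by
    refine CommMonCat.hom_ext (MonoidHom.ext fun x => Prod.ext ?_ ?_)
    · show ((groupificationFunctor Φ).map (f ≫ g)).hom x.1 =
        ((groupificationFunctor Φ).map g).hom (((groupificationFunctor Φ).map f).hom x.1)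
      rw [CategoryTheory.Functor.map_comp]; rfl
    · show ((unitMonoid π).map (f ≫ g)).hom x.2 = ((unitMonoid π).map g).hom (((unitMonoid π).map f).hom x.2)
      rw [CategoryTheory.Functor.map_comp]; rfl

/-- "projecting to the two factors of the product monoid yields natural transformations …
`Φ^fld → Φ^gp`" (FrdII Thm. 3.6, p. 36). [cite: MochizukiFrdII2008, Thm 3.6 p.36] -/
noncomputable def fieldMonoidToGp : fieldMonoid Φ π ⟶ groupificationFunctor Φ where
  app _ := CommMonCat.ofHom (MonoidHom.fst _ _)
  naturality _ _ _ := CommMonCat.hom_ext (MonoidHom.ext fun _ => rfl)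

/-- "… `Φ^fld → Φ^∡`" (FrdII Thm. 3.6, p. 36); stated for monoids `Φ` valued in the universe of `Φ^∡`
(as is the case for the constant monoid `ℝ_{≥0}` of Example 3.3). [cite: MochizukiFrdII2008, Thm 3.6 p.36] -/
noncomputable def fieldMonoidToUnit (Φ' : Dᵒᵖ ⥤ CommMonCat.{0}) : fieldMonoid Φ' π ⟶ unitMonoid π where
  app _ := CommMonCat.ofHom (MonoidHom.snd _ _)
  naturality _ _ _ := CommMonCat.hom_ext (MonoidHom.ext fun _ => rfl)

/-- `(Φ^fld)^Λ`: "`(Φ^fld)^Λ := Φ^fld` (respectively, `:= (Φ^fld)^pf`; `:= Φ^gp`)" for `Λ = ℤ`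
(respectively, `ℚ`; `ℝ`) (FrdII Thm. 3.6, p. 36). [cite: MochizukiFrdII2008, Thm 3.6 p.36] -/
noncomputable def fieldMonoidΛ : MonoidType → (Dᵒᵖ ⥤ CommMonCat.{w})
  | .Z => fieldMonoid Φ π
  | .Q => perfectionFunctor (fieldMonoid Φ π)
  | .R => groupificationFunctor Φ

/-- `(Φ^fld)^ℤ = Φ^fld`. [cite: MochizukiFrdII2008, Thm 3.6 p.36] -/
@[simp] theorem fieldMonoidΛ_Z : fieldMonoidΛ Φ π .Z = fieldMonoid Φ π := rfl

/-- `(Φ^fld)^ℚ = (Φ^fld)^pf`. [cite: MochizukiFrdII2008, Thm 3.6 p.36] -/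
@[simp] theorem fieldMonoidΛ_Q : fieldMonoidΛ Φ π .Q = perfectionFunctor (fieldMonoid Φ π) := rfl

/-- `(Φ^fld)^ℝ = Φ^gp`. [cite: MochizukiFrdII2008, Thm 3.6 p.36] -/
@[simp] theorem fieldMonoidΛ_R : fieldMonoidΛ Φ π .R = groupificationFunctor Φ := rfl

end OverD

end ArchFrd

end Literature.AlgebraicGeometry.Frobenioids
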